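import Mathlib

/-!
# `GrenetZeon.DualUnipotentThreeHalves` (stmt-ValiantsHypothesis-24318), R2 heavy-top instrument — IRREDUCIBLE NILPOTENT SPACES:
# the orbit-cone family `S₃(m)`, part A (lemmas): moving-flag nilpotency and irreducibility from three kinds of generators

Experiment cell «val-heavytop-census» (D-0160), engine seat val-htc-eng-2 g3 (kernel-only lane; no compute).  Part A of the
kernel port of val-idea-29 g7's CLAIM ι (memo `Cruxes/DualUnipotentThreeHalves/MEMO-idea29-g7-orbit-cone-species.md` §1;
contested and CONFIRMED on paper by val-idea-crit-7 g3, `CRITIC-V37-claim-iota-S3.md`, whose «KERNEL ROUTE» this follows):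
`ι(m) ≥ C(m−2,2) + 2` for every `m ≥ 4`, witnessed by

  `S₃(m) := 𝔫_mid ⊕ ℂ·c ⊕ ℂ·v ⊂ M_m(ℂ)`,  `c = E_{T,0} − E_{L,B}`,  `v = E_{L,T} + E_{B,0}`,

in the basis order `e_0, …, e_{k+1}` (= Mid, `m = k+4`, `L := k+1` the last middle index), `e_T` (`T := k+2`), `e_B` (`B := k+3`);
`𝔫_mid` = strictly upper triangular matrices supported on Mid × Mid.  This file holds the two structural lemmas, stated for an
ABSTRACT matrix / subspace by the shape of its rows / its stabilising maps (so that part B only has to read off rows of the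
parametrisation; the count `#{a<b in Fin n} = C(n,2)` of the middle block is ✓ `solo_card_ltPairs`):

* `mulVec_apply_of_row_eq_ite`, `mulVec_apply_of_row_eq_add`, `mulVec_apply_eq_zero_of_row` — a coordinate of `A *ᵥ x` from
  the shape of a row of `A`;
* `pow_eq_zero_of_rows` — MOVING-FLAG NILPOTENCY: a `(k+4) × (k+4)` matrix with the four `S₃` row shapes satisfies `A^{k+4} = 0`
  (it kills `d := α e_T + β e_B`, maps `e_0 ↦ d`, `e_j ↦ span(e_0,…,e_{j−1})` for middle `j ≥ 1`, and everything into `ℂd + Mid`);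
* `eq_bot_or_eq_top_of_stable` — IRREDUCIBILITY: a subspace of `ℂ^{k+4}` stable under `c : x ↦ x_0 e_T − x_B e_L`,
  `v : x ↦ x_T e_L + x_0 e_B` and the middle units `E_{ab} : x ↦ x_b e_a` (`a < b ≤ k+1`) is `0` or everything (any non-zero
  vector is moved onto `e_L` or `e_0`, and `e_0` onto every `e_j`).

Part B (`…HeavyTopIrreducibleSThreeFamily`) assembles `∃ V ≤ M_{k+4}(ℂ)`, `finrank V = C(k+2,2)+2`, nilpotent, irreducible, for
every `k`, and the instances `m = 8, …, 12`.  Honest framing: a lower-bound datum for the instrument; nothing here proves or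
refutes `HeavyTopLaw`/`HeavyTopSlowLaw`, 24318, S3 or 8062; `VP ≠ VNP` is NOT proved.  No definitions.
[val-idea-29 g7 (construction + paper proof); val-idea-crit-7 g3 V37 (check + kernel route); this seat (port)]
-/

noncomputable section

-- single-conjunct layout: Sub = Summit, duplicated namespace component intended
set_option linter.dupNamespace false

namespace Summit.ValiantsHypothesis.ValiantsHypothesis.Theorems.GrenetZeon.HeavyTopIrreducibleSThreeFamily

open Matrix

/-! ## Three bookkeeping lemmas: a coordinate of `A *ᵥ x` from the shape of the row of `A` -/

/-- If row `i` of `A` is `α` at column `a` and `0` elsewhere, then `(A x)_i = α x_a`. -/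
theorem mulVec_apply_of_row_eq_ite {n : ℕ} (A : Matrix (Fin n) (Fin n) ℂ) (i a : Fin n) (α : ℂ)
    (h : ∀ j, A i j = if j = a then α else 0) (x : Fin n → ℂ) : (A *ᵥ x) i = α * x a := by
  simp only [Matrix.mulVec, dotProduct, h, ite_mul, zero_mul, Finset.sum_ite_eq', Finset.mem_univ, if_true]

/-- If row `i` of `A` is `α` at column `a` plus `β` at column `b` (and `0` elsewhere), then `(A x)_i = α x_a + β x_b`. -/
theorem mulVec_apply_of_row_eq_add {n : ℕ} (A : Matrix (Fin n) (Fin n) ℂ) (i a b : Fin n) (α β : ℂ)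
    (h : ∀ j, A i j = (if j = a then α else 0) + (if j = b then β else 0)) (x : Fin n → ℂ) :
    (A *ᵥ x) i = α * x a + β * x b := by
  simp only [Matrix.mulVec, dotProduct, h, add_mul, ite_mul, zero_mul, Finset.sum_add_distrib, Finset.sum_ite_eq',
    Finset.mem_univ, if_true]

/-- If in row `i` every entry of `A` vanishes or meets a vanishing coordinate of `x`, then `(A x)_i = 0`. -/
theorem mulVec_apply_eq_zero_of_row {n : ℕ} (A : Matrix (Fin n) (Fin n) ℂ) (i : Fin n) (x : Fin n → ℂ)
    (h : ∀ j, A i j = 0 ∨ x j = 0) : (A *ᵥ x) i = 0 := by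
  simp only [Matrix.mulVec, dotProduct]
  exact Finset.sum_eq_zero fun j _ => by rcases h j with h | h <;> simp [h]

/-! ## Nilpotency: the moving flag -/

/-- **Moving-flag nilpotency.**  Let `A` be a `(k+4) × (k+4)` matrix whose rows have the `S₃` shapes: row `T` is `α` at column
`0`, row `B` is `β` at column `0`, row `L` is `β` at column `T` and `−α` at column `B`, and each middle row `i ≤ k` is supported
on the middle columns `j` with `i < j ≤ k+1`.  Then `A^{k+4} = 0`: `A` kills `d := α e_T + β e_B`, maps `e_0 ↦ d`,
`e_j ↦ span(e_0, …, e_{j−1})` (`1 ≤ j ≤ k+1`) and everything into `ℂd + Mid`. -/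
theorem pow_eq_zero_of_rows (k : ℕ) (A : Matrix (Fin (k + 4)) (Fin (k + 4)) ℂ) (α β : ℂ)
    (T B L : Fin (k + 4)) (hT : T.val = k + 2) (hB : B.val = k + 3) (hL : L.val = k + 1)
    (rT : ∀ x, (A *ᵥ x) T = α * x 0) (rB : ∀ x, (A *ᵥ x) B = β * x 0)
    (rL : ∀ x, (A *ᵥ x) L = β * x T + (-α) * x B)
    (rM : ∀ i : Fin (k + 4), i.val ≤ k → ∀ x : Fin (k + 4) → ℂ,
      (∀ j : Fin (k + 4), i.val < j.val → j.val ≤ k + 1 → x j = 0) → (A *ᵥ x) i = 0) :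
    A ^ (k + 4) = 0 := by
  -- `Q l x`: `x ∈ ℂ(α e_T + β e_B) + span{e_i : i < l}`; then `A^{l+1} x = 0`.
  have key : ∀ l : ℕ, l ≤ k + 2 → ∀ x : Fin (k + 4) → ℂ,
      (∃ s : ℂ, x T = s * α ∧ x B = s * β ∧ ∀ i : Fin (k + 4), i.val ≤ k + 1 → l ≤ i.val → x i = 0) →
      (A ^ (l + 1)) *ᵥ x = 0 := by
    intro l
    induction l with
    | zero =>
      rintro - x ⟨s, hxT, hxB, hx0⟩
      rw [zero_add, pow_one]
      have hx00 : x 0 = 0 := hx0 0 (by simp) (by simp)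
      ext i
      rw [Pi.zero_apply]
      by_cases h1 : i = T
      · subst h1; rw [rT, hx00, mul_zero]
      by_cases h2 : i = B
      · subst h2; rw [rB, hx00, mul_zero]
      by_cases h3 : i = L
      · subst h3; rw [rL, hxT, hxB]; ring
      have h1' : i.val ≠ k + 2 := fun e => h1 (Fin.ext (by omega))
      have h2' : i.val ≠ k + 3 := fun e => h2 (Fin.ext (by omega))
      have h3' : i.val ≠ k + 1 := fun e => h3 (Fin.ext (by omega))
      exact rM i (by omega) x fun j hij hj => hx0 j hj (by omega)
    | succ l ih =>
      rintro hl x ⟨s, hxT, hxB, hx0⟩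
      rw [pow_succ, ← Matrix.mulVec_mulVec]
      refine ih (by omega) _ ⟨x 0, ?_, ?_, ?_⟩
      · rw [rT]; ring
      · rw [rB]; ring
      · intro i hi hli
        by_cases h3 : i = L
        · subst h3; rw [rL, hxT, hxB]; ring
        have h3' : i.val ≠ k + 1 := fun e => h3 (Fin.ext (by omega))
        exact rM i (by omega) x fun j hij hj => hx0 j hj (by omega)
  have hfin : ∀ x : Fin (k + 4) → ℂ, (A ^ (k + 4)) *ᵥ x = 0 := by
    intro x
    rw [pow_succ, ← Matrix.mulVec_mulVec]
    exact key (k + 2) le_rfl _ ⟨x 0, by rw [rT]; ring, by rw [rB]; ring, fun i hi hli => by omega⟩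
  ext i j
  have h := congr_fun (hfin (Pi.single j 1)) i
  simpa [Matrix.mulVec, dotProduct, Pi.single_apply] using h

/-! ## Irreducibility: every non-zero stable subspace contains `e_0`, and `e_0` generates everything -/

/-- **Irreducibility.**  Let `U ≤ ℂ^{k+4}` be stable under the three kinds of generators of `S₃`: `c : x ↦ x_0 e_T − x_B e_L`,
`v : x ↦ x_T e_L + x_0 e_B`, and the middle matrix units `E_{ab} : x ↦ x_b e_a` (`a < b ≤ k+1`).  Then `U = 0` or `U = ℂ^{k+4}`. -/
theorem eq_bot_or_eq_top_of_stable (k : ℕ) (U : Submodule ℂ (Fin (k + 4) → ℂ))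
    (T B L : Fin (k + 4)) (hT : T.val = k + 2) (hB : B.val = k + 3) (hL : L.val = k + 1)
    (hc : ∀ x ∈ U, x 0 • (Pi.single T (1 : ℂ) : Fin (k + 4) → ℂ) + (-x B) • Pi.single L 1 ∈ U)
    (hv : ∀ x ∈ U, x T • (Pi.single L (1 : ℂ) : Fin (k + 4) → ℂ) + x 0 • Pi.single B 1 ∈ U)
    (hE : ∀ a b : Fin (k + 4), a.val < b.val → b.val ≤ k + 1 →
      ∀ x ∈ U, x b • (Pi.single a (1 : ℂ) : Fin (k + 4) → ℂ) ∈ U) :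
    U = ⊥ ∨ U = ⊤ := by
  classical
  rcases eq_or_ne U ⊥ with h | h
  · exact Or.inl h
  right
  obtain ⟨u, huU, hu⟩ := (Submodule.ne_bot_iff U).1 h
  have h0v : (0 : Fin (k + 4)).val = 0 := by simp
  have hT0 : (0 : Fin (k + 4)) ≠ T := fun e => by rw [Fin.ext_iff] at e; simp at e; omega
  have hB0 : (0 : Fin (k + 4)) ≠ B := fun e => by rw [Fin.ext_iff] at e; simp at e; omega
  have hL0 : (0 : Fin (k + 4)) ≠ L := fun e => by rw [Fin.ext_iff] at e; simp at e; omega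
  have hTB : T ≠ B := fun e => by rw [Fin.ext_iff] at e; omega
  have hTL : T ≠ L := fun e => by rw [Fin.ext_iff] at e; omega
  have hBL : B ≠ L := fun e => by rw [Fin.ext_iff] at e; omega
  -- `e_L ∈ U ⇒ e_0 ∈ U` (the unit `E_{0,L}`)
  have e0_of_eL : (Pi.single L (1 : ℂ) : Fin (k + 4) → ℂ) ∈ U → (Pi.single 0 (1 : ℂ) : Fin (k + 4) → ℂ) ∈ U := by
    intro hL'
    have h1 := hE 0 L (by omega) (by omega) _ hL'
    simpa using h1
  -- `e_0 ∈ U ⇒ e_j ∈ U` for every `j`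
  have all_of_e0 : (Pi.single 0 (1 : ℂ) : Fin (k + 4) → ℂ) ∈ U →
      ∀ j : Fin (k + 4), (Pi.single j (1 : ℂ) : Fin (k + 4) → ℂ) ∈ U := by
    intro h0
    have hT' : (Pi.single T (1 : ℂ) : Fin (k + 4) → ℂ) ∈ U := by
      have h1 := hc _ h0
      simpa [Pi.single_apply, hB0] using h1
    have hB' : (Pi.single B (1 : ℂ) : Fin (k + 4) → ℂ) ∈ U := by
      have h1 := hv _ h0
      simpa [Pi.single_apply, hT0] using h1
    have hL' : (Pi.single L (1 : ℂ) : Fin (k + 4) → ℂ) ∈ U := by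
      have h1 := hv _ hT'
      simpa [Pi.single_apply, hT0.symm] using h1
    intro j
    by_cases hj : j.val ≤ k
    · have h1 := hE j L (by omega) (by omega) _ hL'
      simpa using h1
    · have hj' : j = L ∨ j = T ∨ j = B := by
        rcases Nat.lt_or_ge j.val (k + 4) with h4 | h4
        · by_cases e1 : j.val = k + 1
          · exact Or.inl (Fin.ext (by omega))
          by_cases e2 : j.val = k + 2
          · exact Or.inr (Or.inl (Fin.ext (by omega)))
          exact Or.inr (Or.inr (Fin.ext (by omega)))
        · exact absurd j.isLt (by omega)
      rcases hj' with rfl | rfl | rfl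
      · exact hL'
      · exact hT'
      · exact hB'
  -- `e_0 ∈ U`
  have h0 : (Pi.single 0 (1 : ℂ) : Fin (k + 4) → ℂ) ∈ U := by
    obtain ⟨i, hi⟩ := Function.ne_iff.1 hu
    by_cases hmid : 1 ≤ i.val ∧ i.val ≤ k + 1
    · -- a middle coordinate `u_i ≠ 0`, `i ≥ 1`: `E_{0,i} u = u_i e_0`
      have h1 := hE 0 i (by omega) hmid.2 _ huU
      have h2 := U.smul_mem (u i)⁻¹ h1
      rwa [smul_smul, inv_mul_cancel₀ hi, one_smul] at h2
    · -- `i ∈ {0, T, B}`: reach `e_L`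
      apply e0_of_eL
      have y := hv _ huU
      have z := hc _ y
      have w := hc _ huU
      have hyB : (u T • Pi.single L (1 : ℂ) + u 0 • Pi.single B (1 : ℂ) : Fin (k + 4) → ℂ) B = u 0 := by
        simp [hBL]
      have hy0 : (u T • Pi.single L (1 : ℂ) + u 0 • Pi.single B (1 : ℂ) : Fin (k + 4) → ℂ) 0 = 0 := by
        simp [hL0, hB0]
      rw [hyB, hy0, zero_smul, zero_add] at z
      have hi0 : u i ≠ 0 := hi
      by_cases h00 : u 0 = 0
      · have hi' : i = T ∨ i = B := by
          by_cases e0 : i.val = 0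
          · exact absurd (by rw [show i = 0 from Fin.ext (by omega)]; exact h00) hi0
          by_cases e2 : i.val = k + 2
          · exact Or.inl (Fin.ext (by omega))
          have : i.val < k + 4 := i.isLt
          exact Or.inr (Fin.ext (by omega))
        rcases hi' with e | e
        · -- `u_T ≠ 0`: `v u = u_T e_L`
          rw [e] at hi0
          rw [h00, zero_smul, add_zero] at y
          have h2 := U.smul_mem (u T)⁻¹ y
          rwa [smul_smul, inv_mul_cancel₀ hi0, one_smul] at h2
        · -- `u_B ≠ 0`: `c u = −u_B e_L`
          rw [e] at hi0
          rw [h00, zero_smul, zero_add] at w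
          have h2 := U.smul_mem (-(u B))⁻¹ w
          rwa [smul_smul, inv_mul_cancel₀ (neg_ne_zero.2 hi0), one_smul] at h2
      · -- `u_0 ≠ 0`: `c (v u) = −u_0 e_L`
        have h2 := U.smul_mem (-(u 0))⁻¹ z
        rwa [smul_smul, inv_mul_cancel₀ (neg_ne_zero.2 h00), one_smul] at h2
  rw [eq_top_iff, ← (Pi.basisFun ℂ (Fin (k + 4))).span_eq, Submodule.span_le]
  rintro _ ⟨j, rfl⟩
  rw [SetLike.mem_coe, Pi.basisFun_apply]
  exact all_of_e0 h0 j

end Summit.ValiantsHypothesis.ValiantsHypothesis.Theorems.GrenetZeon.HeavyTopIrreducibleSThreeFamily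

end
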